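import Summits.QuantumFields.QCD.Theses.GaussianLinkFrames
import Summits.QuantumFields.QCD.Theorems.GaussianLinkFramesFrameAPrioriBoundLineDefs
import Summits.QuantumFields.QCD.Theorems.GaussianLinkFramesFrameAPrioriBoundStubCubeSmallBall
import Summits.QuantumFields.QCD.Theorems.GaussianLinkFramesFrameAPrioriBoundStubFibreMoment
import Summits.QuantumFields.QCD.Theorems.GaussianLinkFramesFrameAPrioriBoundStubTiltTransfer
import Summits.QuantumFields.QCD.Theorems.GaussianLinkFramesFrameAPrioriBoundStubConditioning
import Summits.QuantumFields.QCD.Theorems.GaussianLinkFramesFrameAPrioriBoundStubCubeAdjugateNikolskii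
import Literature.MathematicalPhysics.QuantumFieldTheory.QCDPhaseQuenched

/-!
# Crux `FrameAPrioriBound` (stmt-QuantumFields-17374) reduced to mean-square cofactor domination
(line `cube-cofactor`, lead prover-line-stmt-QuantumFields-17374-0, 2026-08-17)

`theorem frameAPrioriBound_of_cubeMeanSquareDomination : (MS) → GaussianLinkFrames.FrameAPrioriBound`
— the registered reduction stub of the crux: the Aizenman–Molchanov-type a-priori fractional-moment
bound for the resolvent of `H = γ₅ D_W(U; m₀, 1)` under the product tilted-Haar law follows from ONE
finite-dimensional statement on the fibre of the links touching the two radius-2 cubes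
`Q₂(x) ∪ Q₂(y)`:

  (MS)  `E_W Σ_{a,i,b,j} |adj(H(refit W) − z)_{(x,a,i),(y,b,j)}|² ≤ C₂ · E_W |det(H(refit W) − z)|²`

uniformly in `L ≥ 4`, `m₀ ∈ [−2,2]`, `|z| ≤ 1`, `x, y` and the exterior `U` (product Haar `E_W`).

The proof is the composition of the five LANDED stubs of the line — relative small balls for `det`
on the cube fibre (`stub_cubeSmallBall`), Nikolskii for the adjugate block
(`stub_cubeAdjugateNikolskii`), the layer-cake fibre moment (`stub_fibreMoment`), the ball-free
untilt (`stub_tiltTransfer`) and conditioning/Fubini for the product law (`stub_conditioning`) —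
through two sorry-free glue lemmas proved here: `cubeCofactorDomination_of_meanSquare` ((N) + (MS)
⇒ sup-form cofactor domination, `C₁ = √(K C₂)`, maximiser of `|det|` over the compact fibre) and
`cruxStatement_of_stubs` (fibre moment ⇒ tilted fibre moment ⇒ crux, with the measurability of the
concrete integrand `measurable_blockSum_inv_rpow`).  What remains open is exactly (MS), registered as
`stub_cubeMeanSquareDomination` on the crux item (skeleton `Cruxes/FrameAPrioriBound/Lines/cube_cofactor.lean`).
-/

noncomputable section

namespace Summit.QuantumFields.QCD.Cruxes.FrameAPrioriBound.CubeCofactor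

open scoped BigOperators Matrix
open MeasureTheory Filter Literature.MathematicalPhysics.QuantumFieldTheory
  Literature.MathematicalPhysics.QuantumLattice Literature.Probability.LatticeModels

variable {L : ℕ}

/-- On a probability space, a pointwise bound `0 ≤ f ≤ c` bounds the (Bochner) integral by `c`
(no measurability needed: `integral_mono_of_nonneg` against the constant). -/
theorem integral_le_of_forall_le {Ω : Type*} [MeasurableSpace Ω] (μ : Measure Ω)
    [IsProbabilityMeasure μ] {f : Ω → ℝ} {c : ℝ} (hf0 : ∀ ω, 0 ≤ f ω) (hfc : ∀ ω, f ω ≤ c) :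
    ∫ ω, f ω ∂μ ≤ c := by
  calc ∫ ω, f ω ∂μ ≤ ∫ _ω, c ∂μ :=
        integral_mono_of_nonneg (Eventually.of_forall hf0) (integrable_const c) (Eventually.of_forall hfc)
    _ = c := by simp

/-- GLUE (sorry-free): Nikolskii (N) + mean-square domination (MS) ⇒ the sup-form cofactor
domination consumed by `stub_fibreMoment`, with `C₁ = √(K C₂)` and `W'` a maximiser of
`W ↦ |det(H(refit W) − z)|` over the compact fibre (`E|det|² ≤ |det(W')|²` needs no integrability:
`integral_mono_of_nonneg` against a constant). -/
theorem cubeCofactorDomination_of_meanSquare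
    (hN : ∃ K : ℝ, 0 < K ∧ ∀ (L : ℕ) [NeZero L], 4 ≤ L →
      ∀ (m₀ : ℝ) (z : ℂ) (x y : TorusSite 4 L) (U W₀ : GaugeConfig 4 L SU3),
      (∑ a : Fin 3, ∑ i : Fin 4, ∑ b : Fin 3, ∑ j : Fin 4,
          ‖(hz (refit (touches x y) U W₀) m₀ z).adjugate (x, a, i) (y, b, j)‖) ^ 2 ≤
        K * ∫ W, (∑ a : Fin 3, ∑ i : Fin 4, ∑ b : Fin 3, ∑ j : Fin 4,
          ‖(hz (refit (touches x y) U W) m₀ z).adjugate (x, a, i) (y, b, j)‖) ^ 2 ∂(haarPi L))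
    (hMS : ∃ C₂ : ℝ, 0 < C₂ ∧ ∀ (L : ℕ) [NeZero L], 4 ≤ L →
      ∀ (m₀ : ℝ), -2 ≤ m₀ → m₀ ≤ 2 → ∀ (z : ℂ), ‖z‖ ≤ 1 → ∀ (x y : TorusSite 4 L)
      (U : GaugeConfig 4 L SU3),
      ∫ W, (∑ a : Fin 3, ∑ i : Fin 4, ∑ b : Fin 3, ∑ j : Fin 4,
          ‖(hz (refit (touches x y) U W) m₀ z).adjugate (x, a, i) (y, b, j)‖) ^ 2 ∂(haarPi L) ≤
        C₂ * ∫ W, ‖(hz (refit (touches x y) U W) m₀ z).det‖ ^ 2 ∂(haarPi L)) :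
    ∃ C₁ : ℝ, 0 < C₁ ∧ ∀ (L : ℕ) [NeZero L], 4 ≤ L →
      ∀ (m₀ : ℝ), -2 ≤ m₀ → m₀ ≤ 2 → ∀ (z : ℂ), ‖z‖ ≤ 1 → ∀ (x y : TorusSite 4 L)
      (U W₀ : GaugeConfig 4 L SU3), ∃ W' : GaugeConfig 4 L SU3,
      (∑ a : Fin 3, ∑ i : Fin 4, ∑ b : Fin 3, ∑ j : Fin 4,
          ‖(hz (refit (touches x y) U W₀) m₀ z).adjugate (x, a, i) (y, b, j)‖) ≤
        C₁ * ‖(hz (refit (touches x y) U W') m₀ z).det‖ := by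
  obtain ⟨K, hK, hN⟩ := hN
  obtain ⟨C₂, hC₂, hMS⟩ := hMS
  refine ⟨Real.sqrt (K * C₂), Real.sqrt_pos.2 (mul_pos hK hC₂), ?_⟩
  intro L _ hL m₀ hm₁ hm₂ z hz₁ x y U W₀
  haveI : IsProbabilityMeasure (haarPi L) := by dsimp only [haarPi]; infer_instance
  -- maximiser of `|det|` over the compact fibre
  have hcont := FibreMoment.continuous_norm_det_hz_refit (touches x y) U m₀ z
  obtain ⟨W', -, hW'⟩ := (isCompact_univ (X := GaugeConfig 4 L SU3)).exists_isMaxOn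
    Set.univ_nonempty hcont.continuousOn
  have hmax : ∀ W : GaugeConfig 4 L SU3, ‖(hz (refit (touches x y) U W) m₀ z).det‖ ≤
      ‖(hz (refit (touches x y) U W') m₀ z).det‖ := fun W => (isMaxOn_iff.1 hW') W (Set.mem_univ W)
  refine ⟨W', ?_⟩
  have hA0 : 0 ≤ ∑ a : Fin 3, ∑ i : Fin 4, ∑ b : Fin 3, ∑ j : Fin 4,
      ‖(hz (refit (touches x y) U W₀) m₀ z).adjugate (x, a, i) (y, b, j)‖ := by positivity
  have hD0 : 0 ≤ ‖(hz (refit (touches x y) U W') m₀ z).det‖ := norm_nonneg _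
  -- `E|det|² ≤ |det(W')|²` (no integrability needed: compare with a constant)
  have hdet : ∫ W, ‖(hz (refit (touches x y) U W) m₀ z).det‖ ^ 2 ∂(haarPi L) ≤
      ‖(hz (refit (touches x y) U W') m₀ z).det‖ ^ 2 :=
    integral_le_of_forall_le (haarPi L) (fun W => pow_nonneg (norm_nonneg _) 2)
      (fun W => pow_le_pow_left₀ (norm_nonneg _) (hmax W) 2)
  have key : (∑ a : Fin 3, ∑ i : Fin 4, ∑ b : Fin 3, ∑ j : Fin 4,
      ‖(hz (refit (touches x y) U W₀) m₀ z).adjugate (x, a, i) (y, b, j)‖) ^ 2 ≤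
      (Real.sqrt (K * C₂) * ‖(hz (refit (touches x y) U W') m₀ z).det‖) ^ 2 := by
    rw [mul_pow, Real.sq_sqrt (mul_pos hK hC₂).le]
    calc _ ≤ K * ∫ W, (∑ a : Fin 3, ∑ i : Fin 4, ∑ b : Fin 3, ∑ j : Fin 4,
          ‖(hz (refit (touches x y) U W) m₀ z).adjugate (x, a, i) (y, b, j)‖) ^ 2 ∂(haarPi L) :=
          hN L hL m₀ z x y U W₀
      _ ≤ K * (C₂ * ∫ W, ‖(hz (refit (touches x y) U W) m₀ z).det‖ ^ 2 ∂(haarPi L)) :=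
          mul_le_mul_of_nonneg_left (hMS L hL m₀ hm₁ hm₂ z hz₁ x y U) hK.le
      _ ≤ K * (C₂ * ‖(hz (refit (touches x y) U W') m₀ z).det‖ ^ 2) :=
          mul_le_mul_of_nonneg_left (mul_le_mul_of_nonneg_left hdet hC₂.le) hK.le
      _ = (K * C₂) * ‖(hz (refit (touches x y) U W') m₀ z).det‖ ^ 2 := by ring
  exact (pow_le_pow_iff_left₀ hA0 (mul_nonneg (Real.sqrt_nonneg _) hD0) two_ne_zero).1 key

/-! STUB `fibreMoment` — LANDED (p166892, `Theorems/GaussianLinkFramesFrameAPrioriBoundStubFibreMoment.lean`,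
layer cake `stub_negMomentOfSmallBalls`, `det_hz_ne_zero`, Cramer `Matrix.inv_def`); imported. -/

/-! STUB `tiltTransfer` — LANDED (p167682, `Theorems/GaussianLinkFramesFrameAPrioriBoundStubTiltTransfer.lean`,
untilt `CircleTransport.stub_circleUntilt` at n = 10⁴, K = 9, β := 1 + B); imported. -/

/-! STUB `conditioning` — LANDED (p168158, `Theorems/GaussianLinkFramesFrameAPrioriBoundStubConditioning.lean`,
`stub_piResample` twice + a.e. finiteness; generic `Conditioning.conditioning`); imported. -/

/-! ### Composition -/

/-- Measurability of the concrete integrand `V ↦ (Σ_{a,i,b,j} ‖((H(V) − z)⁻¹)_{(x,a,i),(y,b,j)}‖)^s`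
on the whole configuration space (including the junk locus `det = 0`, where Mathlib's matrix inverse
is `0`): by `Matrix.inv_def` each entry is `Ring.inverse (det) · adjugate entry`, a measurable
function (`Ring.inverse = (·)⁻¹` on `ℂ`) of the continuous matrix `V ↦ H(V) − z`
(`continuous_wilsonDirac`). -/
theorem measurable_blockSum_inv_rpow [NeZero L] (m₀ : ℝ) (z : ℂ) (x y : TorusSite 4 L) (s : ℝ) :
    Measurable fun V : GaugeConfig 4 L SU3 => (∑ a : Fin 3, ∑ i : Fin 4, ∑ b : Fin 3, ∑ j : Fin 4,
      ‖(hz V m₀ z)⁻¹ (x, a, i) (y, b, j)‖) ^ s := by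
  have hc : Continuous fun V : GaugeConfig 4 L SU3 => hz V m₀ z :=
    (continuous_const.mul (continuous_wilsonDirac (fundamentalRep (Fin 3))
      (continuous_fundamentalRep (Fin 3)) m₀ 1)).sub continuous_const
  have hentry : ∀ p q : TorusSite 4 L × Fin 3 × Fin 4,
      Measurable fun V : GaugeConfig 4 L SU3 => (hz V m₀ z)⁻¹ p q := by
    intro p q
    have heq : (fun V : GaugeConfig 4 L SU3 => (hz V m₀ z)⁻¹ p q) =
        fun V => Ring.inverse (hz V m₀ z).det * (hz V m₀ z).adjugate p q := by
      funext V
      rw [Matrix.inv_def, Matrix.smul_apply, smul_eq_mul]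
    rw [heq]
    refine Measurable.mul ?_ (hc.matrix_adjugate.matrix_elem p q).measurable
    rw [Ring.inverse_eq_inv']
    exact hc.matrix_det.measurable.inv
  refine Measurable.pow_const ?_ _
  refine Finset.measurable_sum _ fun a _ => Finset.measurable_sum _ fun i _ =>
    Finset.measurable_sum _ fun b _ => Finset.measurable_sum _ fun j _ => ?_
  exact (hentry _ _).norm

/-- IMPLICATION FORM (kernel-checked, sorry-free): the five stub STATEMENTS of line `cube-cofactor`
imply the crux.  Small balls + (sup-form) cofactor domination give the exterior-uniform Haar fibre
moment (`fibreMoment`), the untilt (`tiltTransfer`, applied on each fibre to `F := G_s ∘ refit S U`)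
turns it into an exterior-uniform tilted fibre bound `C(1+B)^p C₀`, and Fubini (`conditioning`, with
`S :=` the links touching `Q₂(x) ∪ Q₂(y)` and `F :=` the `s`-th power of the `(x,y)` block sum of
`|G|`, measurable by `measurable_blockSum_inv_rpow`) integrates the exterior out. -/
theorem cruxStatement_of_stubs
    (h₁ : ∃ c α : ℝ, 0 < c ∧ 0 < α ∧ ∀ (L : ℕ) [NeZero L], 4 ≤ L →
      ∀ (m₀ : ℝ) (z : ℂ) (x y : TorusSite 4 L) (U W₀ : GaugeConfig 4 L SU3),
      (hz (refit (touches x y) U W₀) m₀ z).det ≠ 0 → ∀ ε : ℝ, 0 < ε →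
      haarPi L {W | ‖(hz (refit (touches x y) U W) m₀ z).det‖ ≤
          ε * ‖(hz (refit (touches x y) U W₀) m₀ z).det‖} ≤ ENNReal.ofReal (c * ε ^ α))
    (h₂ : ∃ C₁ : ℝ, 0 < C₁ ∧ ∀ (L : ℕ) [NeZero L], 4 ≤ L →
      ∀ (m₀ : ℝ), -2 ≤ m₀ → m₀ ≤ 2 → ∀ (z : ℂ), ‖z‖ ≤ 1 → ∀ (x y : TorusSite 4 L)
      (U W₀ : GaugeConfig 4 L SU3), ∃ W' : GaugeConfig 4 L SU3,
      (∑ a : Fin 3, ∑ i : Fin 4, ∑ b : Fin 3, ∑ j : Fin 4,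
          ‖(hz (refit (touches x y) U W₀) m₀ z).adjugate (x, a, i) (y, b, j)‖) ≤
        C₁ * ‖(hz (refit (touches x y) U W') m₀ z).det‖)
    (h₃ : (∃ c α : ℝ, 0 < c ∧ 0 < α ∧ ∀ (L : ℕ) [NeZero L], 4 ≤ L →
        ∀ (m₀ : ℝ) (z : ℂ) (x y : TorusSite 4 L) (U W₀ : GaugeConfig 4 L SU3),
        (hz (refit (touches x y) U W₀) m₀ z).det ≠ 0 → ∀ ε : ℝ, 0 < ε →
        haarPi L {W | ‖(hz (refit (touches x y) U W) m₀ z).det‖ ≤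
            ε * ‖(hz (refit (touches x y) U W₀) m₀ z).det‖} ≤ ENNReal.ofReal (c * ε ^ α)) →
      (∃ C₁ : ℝ, 0 < C₁ ∧ ∀ (L : ℕ) [NeZero L], 4 ≤ L →
        ∀ (m₀ : ℝ), -2 ≤ m₀ → m₀ ≤ 2 → ∀ (z : ℂ), ‖z‖ ≤ 1 → ∀ (x y : TorusSite 4 L)
        (U W₀ : GaugeConfig 4 L SU3), ∃ W' : GaugeConfig 4 L SU3,
        (∑ a : Fin 3, ∑ i : Fin 4, ∑ b : Fin 3, ∑ j : Fin 4,
            ‖(hz (refit (touches x y) U W₀) m₀ z).adjugate (x, a, i) (y, b, j)‖) ≤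
          C₁ * ‖(hz (refit (touches x y) U W') m₀ z).det‖) →
      ∃ s C₀ : ℝ, 0 < s ∧ s < 1 ∧ 0 < C₀ ∧ ∀ (L : ℕ) [NeZero L], 4 ≤ L →
        ∀ (m₀ : ℝ), -2 ≤ m₀ → m₀ ≤ 2 → ∀ (z : ℂ), z.im ≠ 0 → ‖z‖ ≤ 1 → ∀ (x y : TorusSite 4 L)
        (U : GaugeConfig 4 L SU3),
        ∫ W, (∑ a : Fin 3, ∑ i : Fin 4, ∑ b : Fin 3, ∑ j : Fin 4,
            ‖(hz (refit (touches x y) U W) m₀ z)⁻¹ (x, a, i) (y, b, j)‖) ^ s ∂(haarPi L) ≤ C₀)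
    (h₄ : ∃ C p : ℝ, 0 < C ∧ ∀ (L : ℕ) [NeZero L], 4 ≤ L →
      ∀ (x y : TorusSite 4 L) (B : ℝ), 0 ≤ B →
      ∀ J : Edge 4 L → Matrix (Fin 3) (Fin 3) ℂ, (∀ e i j, ‖J e i j‖ ≤ B) →
      ∀ (F : GaugeConfig 4 L SU3 → ℝ), (∀ W, 0 ≤ F W) → ∀ M : ℝ,
      ∫ W, F W ∂(haarPi L) ≤ M →
      (∫ W, F W * tiltWt (touches x y) J W ∂(haarPi L)) /
          (∫ W, tiltWt (touches x y) J W ∂(haarPi L)) ≤ C * (1 + B) ^ p * M)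
    (h₅ : ∀ (L : ℕ) [NeZero L] (S : Edge 4 L → Bool)
      (J : Edge 4 L → Matrix (Fin 3) (Fin 3) ℂ) (F : GaugeConfig 4 L SU3 → ℝ), Measurable F →
      (∀ U, 0 ≤ F U) → ∀ M : ℝ,
      (∀ U : GaugeConfig 4 L SU3,
        (∫ W, F (refit S U W) * tiltWt S J W ∂(haarPi L)) / (∫ W, tiltWt S J W ∂(haarPi L)) ≤ M) →
      (∫ U, F U * Real.exp (∑ e : Edge 4 L, (((U e : SU3) : Matrix (Fin 3) (Fin 3) ℂ) * (J e)ᴴ).trace.re)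
          ∂(Measure.pi fun _ : Edge 4 L => haarProbability SU3)) /
        (∫ U, Real.exp (∑ e : Edge 4 L, (((U e : SU3) : Matrix (Fin 3) (Fin 3) ℂ) * (J e)ᴴ).trace.re)
          ∂(Measure.pi fun _ : Edge 4 L => haarProbability SU3)) ≤ M) :
    Summit.QuantumFields.QCD.Theses.GaussianLinkFrames.FrameAPrioriBound := by
  obtain ⟨s, C₀, hs0, hs1, hC₀, hfib⟩ := h₃ h₁ h₂
  obtain ⟨C, p, hC, htilt⟩ := h₄
  refine ⟨s, C * C₀, p, hs0, hs1, mul_pos hC hC₀, ?_⟩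
  intro L _ hL m₀ hm₁ hm₂ B hB J hJ z hz₀ hz₁ x y
  have key := h₅ L (touches x y) J
    (fun V : GaugeConfig 4 L SU3 => (∑ a : Fin 3, ∑ i : Fin 4, ∑ b : Fin 3, ∑ j : Fin 4,
      ‖(hz V m₀ z)⁻¹ (x, a, i) (y, b, j)‖) ^ s)
    (measurable_blockSum_inv_rpow m₀ z x y s)
    (fun V => Real.rpow_nonneg (by positivity) s) (C * (1 + B) ^ p * C₀)
    (fun U => htilt L hL x y B hB J hJ
      (fun W => (∑ a : Fin 3, ∑ i : Fin 4, ∑ b : Fin 3, ∑ j : Fin 4,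
        ‖(hz (refit (touches x y) U W) m₀ z)⁻¹ (x, a, i) (y, b, j)‖) ^ s)
      (fun W => Real.rpow_nonneg (by positivity) s) C₀
      (hfib L hL m₀ hm₁ hm₂ z hz₀ hz₁ x y U))
  calc _ ≤ C * (1 + B) ^ p * C₀ := key
    _ = C * C₀ * (1 + B) ^ p := by ring

/-- **The crux modulo mean-square cofactor domination** (registered reduction stub
`frameAPrioriBound_of_cubeMeanSquareDomination` of stmt-QuantumFields-17374): (MS) on the two-cube
fibre implies `GaussianLinkFrames.FrameAPrioriBound`, by the five landed stubs of line
`cube-cofactor` and the glue above. -/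
theorem frameAPrioriBound_of_cubeMeanSquareDomination : (∃ C₂ : ℝ, 0 < C₂ ∧ ∀ (L : ℕ) [NeZero L], 4 ≤ L → ∀ (m₀ : ℝ), -2 ≤ m₀ → m₀ ≤ 2 → ∀ (z : ℂ), ‖z‖ ≤ 1 → ∀ (x y : TorusSite 4 L) (U : GaugeConfig 4 L SU3), ∫ W, (∑ a : Fin 3, ∑ i : Fin 4, ∑ b : Fin 3, ∑ j : Fin 4, ‖(hz (refit (touches x y) U W) m₀ z).adjugate (x, a, i) (y, b, j)‖) ^ 2 ∂(haarPi L) ≤ C₂ * ∫ W, ‖(hz (refit (touches x y) U W) m₀ z).det‖ ^ 2 ∂(haarPi L)) → Summit.QuantumFields.QCD.Theses.GaussianLinkFrames.FrameAPrioriBound :=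
  fun hMS => cruxStatement_of_stubs stub_cubeSmallBall
    (cubeCofactorDomination_of_meanSquare stub_cubeAdjugateNikolskii hMS)
    stub_fibreMoment stub_tiltTransfer stub_conditioning

end Summit.QuantumFields.QCD.Cruxes.FrameAPrioriBound.CubeCofactor

end
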